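import Literature.Algebra.Homology.ExtLocalizationDevissage
import Mathlib.CategoryTheory.Preadditive.Biproducts
import HarnessLib

/-!
# Local–global maps on `Ext`: injectivity / surjectivity are stable under isomorphisms and binary
# biproducts in the source (so permutation-level inputs may be checked on `Coind_U(ℤ)` alone)

Topic `Algebra/Homology`; namespace `Literature.Algebra.Homology.ExtLocalization`.  Theorems only; no
named fact, no instance, no `sorry`.  Sequel of `ExtLocalizationDevissage` (bsd-eis -w4 g20, E1: the
localisation map `locMap L q A n : Extⁿ_C(A, B) →+ ∏ᵢ Extⁿ_{D i}((L i) A, Y i)` of a family of exact functors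
`L i` and coefficient maps `q i`, natural in `A`).

* `locMap_injective_of_iso`, `locMap_surjective_of_iso` — transport along `A ≅ A'`;
* `locMap_injective_biprod`, `locMap_surjective_biprod` — for a binary biproduct `A₁ ⊞ A₂` the
  localisation map is injective (onto) as soon as it is so on `A₁` and on `A₂` (`x = fst^*(inl^* x) +
  snd^*(inr^* x)` from `biprod.total`, the `L i` additive).

USE (lane «PT-Ш-S-TC», crux `stmt-BirchSwinnertonDyer-19032`, brick (Λ)(e)): the permutation-level inputs of
`DiscreteRep.locMap_injective_two_of_permutation` concern `Coind_U^Γ(ℤ^m)` for all `m`; since `Coind_U` is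
additive, `Coind_U(ℤ^{m+1}) ≅ Coind_U(ℤ^m) ⊞ Coind_U(ℤ)`, and these lemmas reduce them to `m = 1`
(Milne I Lemma 4.13 is likewise proved summand by summand).  HONEST FRAMING: homological algebra only.

## References
* J. S. Milne, *Arithmetic Duality Theorems*, 2nd ed. (2006), I Lemma 4.13, I §0. [MilneADT2006]
* S. Mac Lane, *Homology*, Grundlehren 114 (1963), I §3, IX §1 (additive functors and biproducts).
  [MacLane1963Homology]
-/

noncomputable section

universe w w' v v' u u' t

namespace Literature.Algebra.Homology

namespace ExtLocalization

open CategoryTheory CategoryTheory.Limits CategoryTheory.Abelian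

variable {C : Type u} [Category.{v} C] [Abelian C] [HasExt.{w} C]
  {ι : Type t} {D : ι → Type u'} [∀ i, Category.{v'} (D i)] [∀ i, Abelian (D i)]
  [∀ i, HasExt.{w'} (D i)]
  (L : ∀ i, C ⥤ D i) [∀ i, (L i).Additive] [∀ i, PreservesFiniteLimits (L i)]
  [∀ i, PreservesFiniteColimits (L i)]
  {B : C} {Y : ∀ i, D i} (q : ∀ i, (L i).obj B ⟶ Y i)

/-! ## §1 Naturality in the source, pointwise -/

/-- Pointwise naturality: `locMap A' n ([g] ∘ x) i = [(L i) g] ∘ locMap A n x i`.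
[cite: MilneADT2006, I §0] -/
theorem locMap_mk₀_comp {A A' : C} (g : A' ⟶ A) (n : ℕ) (x : Ext A B n) (i : ι) :
    locMap L q A' n ((Ext.mk₀ g).comp x (zero_add n)) i =
      (Ext.mk₀ ((L i).map g)).comp (locMap L q A n x i) (zero_add n) := by
  have h := congrArg (fun φ => φ x i) (locMap_comp_precomp_mk₀ L q g n)
  exact h.symm

/-! ## §2 Isomorphisms in the source -/

/-- **Injectivity transports along `A ≅ A'`.** [cite: MilneADT2006, I §0] -/
theorem locMap_injective_of_iso {A A' : C} (e : A ≅ A') (n : ℕ)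
    (h : Function.Injective (locMap L q A n)) : Function.Injective (locMap L q A' n) := by
  intro x₁ x₂ hx
  have h' : (Ext.mk₀ e.hom).comp x₁ (zero_add n) = (Ext.mk₀ e.hom).comp x₂ (zero_add n) := by
    apply h
    funext i
    rw [locMap_mk₀_comp, locMap_mk₀_comp, hx]
  have := congrArg (fun z => (Ext.mk₀ e.inv).comp z (zero_add n)) h'
  simpa only [Ext.mk₀_comp_mk₀_assoc, Iso.inv_hom_id, Ext.mk₀_id_comp] using this

/-- **Surjectivity transports along `A ≅ A'`.** [cite: MilneADT2006, I §0] -/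
theorem locMap_surjective_of_iso {A A' : C} (e : A ≅ A') (n : ℕ)
    (h : Function.Surjective (locMap L q A n)) : Function.Surjective (locMap L q A' n) := by
  intro y'
  obtain ⟨x, hx⟩ := h (piMap (fun i => (Ext.mk₀ ((L i).map e.hom)).precomp (Y i) (zero_add n)) y')
  refine ⟨(Ext.mk₀ e.inv).comp x (zero_add n), funext fun i => ?_⟩
  rw [locMap_mk₀_comp, hx, piMap_apply]
  change (Ext.mk₀ ((L i).map e.inv)).comp ((Ext.mk₀ ((L i).map e.hom)).comp (y' i) (zero_add n))
    (zero_add n) = y' i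
  rw [Ext.mk₀_comp_mk₀_assoc, ← CategoryTheory.Functor.map_comp, Iso.inv_hom_id, CategoryTheory.Functor.map_id, Ext.mk₀_id_comp]

/-! ## §3 Binary biproducts in the source -/

section Biprod

variable {A₁ A₂ : C} [HasBinaryBiproduct A₁ A₂]

omit [∀ i, PreservesFiniteLimits (L i)] [∀ i, PreservesFiniteColimits (L i)] in
/-- `x = fst^* (inl^* x) + snd^* (inr^* x)` on `Extⁿ(A₁ ⊞ A₂, B)` (`biprod.total`).
[cite: MacLane1963Homology, IX §1] -/
theorem ext_biprod_decomp (n : ℕ) (x : Ext (A₁ ⊞ A₂) B n) :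
    x = (Ext.mk₀ (biprod.fst : A₁ ⊞ A₂ ⟶ A₁)).comp ((Ext.mk₀ (biprod.inl : A₁ ⟶ A₁ ⊞ A₂)).comp x
        (zero_add n)) (zero_add n) +
      (Ext.mk₀ (biprod.snd : A₁ ⊞ A₂ ⟶ A₂)).comp ((Ext.mk₀ (biprod.inr : A₂ ⟶ A₁ ⊞ A₂)).comp x
        (zero_add n)) (zero_add n) := by
  rw [Ext.mk₀_comp_mk₀_assoc, Ext.mk₀_comp_mk₀_assoc, ← Ext.add_comp, ← Ext.mk₀_add, biprod.total,
    Ext.mk₀_id_comp]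

/-- **Injectivity on `A₁ ⊞ A₂` from injectivity on `A₁` and `A₂`.** [cite: MilneADT2006, I Lemma 4.13]
[cite: MacLane1963Homology, IX §1] -/
theorem locMap_injective_biprod (n : ℕ) (h₁ : Function.Injective (locMap L q A₁ n))
    (h₂ : Function.Injective (locMap L q A₂ n)) : Function.Injective (locMap L q (A₁ ⊞ A₂) n) := by
  rw [injective_iff_map_eq_zero]
  intro x hx
  have e₁ : (Ext.mk₀ (biprod.inl : A₁ ⟶ A₁ ⊞ A₂)).comp x (zero_add n) = 0 := by
    rw [← (injective_iff_map_eq_zero _).1 h₁ _ ?_]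
    funext i
    rw [locMap_mk₀_comp, hx, Pi.zero_apply, Ext.comp_zero, Pi.zero_apply]
  have e₂ : (Ext.mk₀ (biprod.inr : A₂ ⟶ A₁ ⊞ A₂)).comp x (zero_add n) = 0 := by
    rw [← (injective_iff_map_eq_zero _).1 h₂ _ ?_]
    funext i
    rw [locMap_mk₀_comp, hx, Pi.zero_apply, Ext.comp_zero, Pi.zero_apply]
  rw [ext_biprod_decomp n x, e₁, e₂, Ext.comp_zero, Ext.comp_zero, add_zero]

/-- **Surjectivity onto `A₁ ⊞ A₂` from surjectivity on `A₁` and `A₂`** (the `L i` are additive).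
[cite: MilneADT2006, I Lemma 4.13][cite: MacLane1963Homology, IX §1] -/
theorem locMap_surjective_biprod (n : ℕ) (h₁ : Function.Surjective (locMap L q A₁ n))
    (h₂ : Function.Surjective (locMap L q A₂ n)) : Function.Surjective (locMap L q (A₁ ⊞ A₂) n) := by
  intro y
  obtain ⟨x₁, hx₁⟩ :=
    h₁ (piMap (fun i => (Ext.mk₀ ((L i).map (biprod.inl : A₁ ⟶ A₁ ⊞ A₂))).precomp (Y i) (zero_add n)) y)
  obtain ⟨x₂, hx₂⟩ :=
    h₂ (piMap (fun i => (Ext.mk₀ ((L i).map (biprod.inr : A₂ ⟶ A₁ ⊞ A₂))).precomp (Y i) (zero_add n)) y)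
  refine ⟨(Ext.mk₀ (biprod.fst : A₁ ⊞ A₂ ⟶ A₁)).comp x₁ (zero_add n) +
    (Ext.mk₀ (biprod.snd : A₁ ⊞ A₂ ⟶ A₂)).comp x₂ (zero_add n), funext fun i => ?_⟩
  rw [map_add, Pi.add_apply, locMap_mk₀_comp, locMap_mk₀_comp, hx₁, hx₂, piMap_apply, piMap_apply]
  change (Ext.mk₀ ((L i).map biprod.fst)).comp ((Ext.mk₀ ((L i).map biprod.inl)).comp (y i) (zero_add n))
      (zero_add n) +
    (Ext.mk₀ ((L i).map biprod.snd)).comp ((Ext.mk₀ ((L i).map biprod.inr)).comp (y i) (zero_add n))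
      (zero_add n) = y i
  rw [Ext.mk₀_comp_mk₀_assoc, Ext.mk₀_comp_mk₀_assoc, ← Ext.add_comp, ← Ext.mk₀_add, ← CategoryTheory.Functor.map_comp,
    ← CategoryTheory.Functor.map_comp, ← (L i).map_add, biprod.total, CategoryTheory.Functor.map_id, Ext.mk₀_id_comp]

end Biprod

end ExtLocalization

end Literature.Algebra.Homology

end
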